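import Literature.AlgebraicGeometry.FundamentalGroup.RiemannExistenceFullyFaithful
import Literature.AlgebraicGeometry.Motives.AlgPointsProductProofs
import Literature.AlgebraicGeometry.HodgeTheory.HypersurfaceComplexPoints
import Literature.NumberTheory.Transcendental.AnalytificationSeparatedProofs
import Mathlib.CategoryTheory.Limits.Shapes.Diagonal
import HarnessLib

/-!
# Riemann's existence theorem, part 1 over a separated base: continuous maps of covers are algebraic

Topic `Literature/AlgebraicGeometry/FundamentalGroup`; third proof file (theorems only) attached
to the named fact `riemannExistence_finiteCovering` (`RiemannExistenceCovering.lean`). It removes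
the two analytic hypotheses of `existsUnique_hom_comp_eq_and_map_eq_of_continuous`
(`RiemannExistenceFullyFaithful.lean`) — local injectivity of `g₂(ℂ)` and Hausdorffness of
`Y₂(ℂ)` — when the base `X` is SEPARATED over `ℂ` (e.g. quasi-projective), by the two
comparison facts of SGA1 XII §§1–3 they stand for:

* `isEmbedding_map_fst_snd` — **complex points of a fibre product** (SGA1 XII 1.2,
  `(X ×_Z Y)^an = X^an ×_{Z^an} Y^an`, point-set part): for `g₁ : Y₁ ⟶ X`, `g₂ : Y₂ ⟶ X` with `X`
  separated over `ℂ`, `R ↦ (p₁ R, p₂ R)` is a topological embedding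
  `(Y₁ ×_X Y₂)(ℂ) ↪ Y₁(ℂ) × Y₂(ℂ)`. Proof: it is the composite of `c(ℂ)` for the closed immersion
  `c : Y₁ ×_X Y₂ ⟶ Y₁ ×_ℂ Y₂` (base change of the diagonal of `X`, Mathlib
  `pullback_map_diagonal_isPullback`; `isClosedImmersion_lift_fst_snd_left`), an embedding by the
  tree's `AlgPoints.isEmbedding_map_of_isClosedImmersion`, with the homeomorphism
  `(Y₁ ×_ℂ Y₂)(ℂ) ≃ₜ Y₁(ℂ) × Y₂(ℂ)` (`AlgPoints.isHomeomorph_prodEquiv_holds`).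
* `isLocallyInjective_map_of_formallyUnramified` — **`g(ℂ)` is locally injective for `g`
  unramified** (SGA1 XII Prop. 3.1 (ii), the topological shadow of «net»): the diagonal
  `Y ⟶ Y ×_X Y` of an unramified `g` is an open immersion (Mathlib `isOpenImmersion_diagonal`), so
  the diagonal of `Y(ℂ)` is open in `(Y ×_X Y)(ℂ)`, i.e. (by the embedding above) it is cut out
  near each point by a product neighbourhood `U × U`, on which `g(ℂ)` is then injective.
* `existsUnique_hom_comp_eq_and_map_eq` — **part 1 of SGA1 XII Thm. 5.1 over a separated base,
  covering form**: for `X` separated over `ℂ`, `Y₁` locally of finite type over `ℂ`,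
  `g₂ : Y₂ ⟶ X` finite étale, every continuous `Ψ : Y₁(ℂ) → Y₂(ℂ)` over `X(ℂ)` is `u(ℂ)` for a
  unique `u ∈ Hom_X(Y₁, Y₂)`.

## References

* [SGA1] A. Grothendieck, M. Raynaud, *SGA 1* (LNM 224 / arXiv:math/0206203), Exp. XII §1
  (1.2), Prop. 3.1 (ii), Thm. 5.1 part 1 (p. 333 of the SMF edition).
-/

noncomputable section

open CategoryTheory CategoryTheory.Limits AlgebraicGeometry MonoidalCategory
open _root_.Topology _root_.TopologicalSpace

namespace Literature.AlgebraicGeometry.FundamentalGroup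

open Literature.AlgebraicGeometry.Motives Literature.AlgebraicGeometry.Motives.AlgPoints
open Literature.AlgebraicGeometry.Motives.ComplexPoints Literature.NumberTheory.Transcendental

variable {X : Motives.SchemeOver ℂ}

/-! ### Complex points of fibre products (SGA1 XII 1.2, point-set part) -/

section FibreProduct

variable {Y₁ Y₂ : Motives.SchemeOver ℂ} (g₁ : Y₁ ⟶ X) (g₂ : Y₂ ⟶ X)

/-- **`Y₁ ×_X Y₂ ⟶ Y₁ ×_ℂ Y₂` is a closed immersion for `X` separated over `ℂ`**: on underlying
schemes it is, up to the isomorphisms `(Y₁ ×_X Y₂).left ≅ Y₁.left ×_{X.left} Y₂.left`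
(`Over.forget` preserves pullbacks) and `Y₁.left ×_{Spec ℂ} Y₂.left ≅ (Y₁ ×_ℂ Y₂).left`, the base
change of the diagonal `X.left ⟶ X.left ×_{Spec ℂ} X.left` (Mathlib
`pullback_map_diagonal_isPullback`), which is a closed immersion. [folklore] -/
theorem isClosedImmersion_lift_fst_snd_left [IsSeparated X.hom] :
    IsClosedImmersion
      (CartesianMonoidalCategory.lift (pullback.fst g₁ g₂) (pullback.snd g₁ g₂)).left := by
  -- work on underlying schemes, with `(Y₁ ⊗ Y₂).left = Y₁.left ×_{Spec ℂ} Y₂.left` definitionally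
  change @IsClosedImmersion (pullback g₁ g₂).left (pullback Y₁.hom Y₂.hom)
    (pullback.lift (pullback.fst g₁ g₂).left (pullback.snd g₁ g₂).left
      ((Over.w (pullback.fst g₁ g₂)).trans (Over.w (pullback.snd g₁ g₂)).symm))
  -- comparison isomorphisms and the base change `m` of the diagonal of `X`
  let e : (pullback g₁ g₂).left ≅ pullback g₁.left g₂.left :=
    PreservesPullback.iso (Over.forget (Spec (CommRingCat.of ℂ))) g₁ g₂
  have he₁ : e.hom ≫ pullback.fst g₁.left g₂.left = (pullback.fst g₁ g₂).left :=
    PreservesPullback.iso_hom_fst (Over.forget (Spec (CommRingCat.of ℂ))) g₁ g₂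
  have he₂ : e.hom ≫ pullback.snd g₁.left g₂.left = (pullback.snd g₁ g₂).left :=
    PreservesPullback.iso_hom_snd (Over.forget (Spec (CommRingCat.of ℂ))) g₁ g₂
  let m : pullback g₁.left g₂.left ⟶ pullback (g₁.left ≫ X.hom) (g₂.left ≫ X.hom) :=
    pullback.map g₁.left g₂.left (g₁.left ≫ X.hom) (g₂.left ≫ X.hom) (𝟙 _) (𝟙 _) X.hom
      (Category.id_comp _).symm (Category.id_comp _).symm
  have hm₁ : m ≫ pullback.fst _ _ = pullback.fst _ _ := by
    change pullback.map _ _ _ _ _ _ _ _ _ ≫ _ = _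
    rw [pullback.lift_fst, Category.comp_id]
  have hm₂ : m ≫ pullback.snd _ _ = pullback.snd _ _ := by
    change pullback.map _ _ _ _ _ _ _ _ _ ≫ _ = _
    rw [pullback.lift_snd, Category.comp_id]
  let κ : pullback (g₁.left ≫ X.hom) (g₂.left ≫ X.hom) ≅ pullback Y₁.hom Y₂.hom :=
    pullback.congrHom (Over.w g₁) (Over.w g₂)
  have hκ₁ : κ.hom ≫ pullback.fst _ _ = pullback.fst _ _ := by
    change (pullback.congrHom _ _).hom ≫ _ = _
    rw [pullback.congrHom_hom, pullback.lift_fst, Category.comp_id]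
  have hκ₂ : κ.hom ≫ pullback.snd _ _ = pullback.snd _ _ := by
    change (pullback.congrHom _ _).hom ≫ _ = _
    rw [pullback.congrHom_hom, pullback.lift_snd, Category.comp_id]
  have hm : IsClosedImmersion m :=
    MorphismProperty.of_isPullback (P := @IsClosedImmersion)
      (pullback_map_diagonal_isPullback g₁.left g₂.left X.hom) IsSeparated.isClosedImmersion_diagonal
  have hc : pullback.lift (pullback.fst g₁ g₂).left (pullback.snd g₁ g₂).left
      ((Over.w (pullback.fst g₁ g₂)).trans (Over.w (pullback.snd g₁ g₂)).symm) = e.hom ≫ m ≫ κ.hom := by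
    apply pullback.hom_ext
    · rw [pullback.lift_fst, Category.assoc, Category.assoc, hκ₁, hm₁, he₁]
    · rw [pullback.lift_snd, Category.assoc, Category.assoc, hκ₂, hm₂, he₂]
  rw [hc, MorphismProperty.cancel_left_of_respectsIso @IsClosedImmersion,
    MorphismProperty.cancel_right_of_respectsIso @IsClosedImmersion]
  exact hm

/-- **Complex points of a fibre product embed into the product of complex points** (SGA1 XII 1.2,
point-set part; `X` separated over `ℂ`): `R ↦ (p₁ R, p₂ R)`,
`(Y₁ ×_X Y₂)(ℂ) → Y₁(ℂ) × Y₂(ℂ)`, is a topological embedding — the composite of `c(ℂ)` for the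
closed immersion `c : Y₁ ×_X Y₂ ⟶ Y₁ ×_ℂ Y₂` (`AlgPoints.isEmbedding_map_of_isClosedImmersion`)
and the homeomorphism `(Y₁ ×_ℂ Y₂)(ℂ) ≃ Y₁(ℂ) × Y₂(ℂ)` (`AlgPoints.isHomeomorph_prodEquiv_holds`).
[cite: SGA1, Exp. XII §1 (1.2)] -/
theorem isEmbedding_map_fst_snd [IsSeparated X.hom] :
    IsEmbedding fun R : Motives.ComplexPoints (pullback g₁ g₂) ↦
      (AlgPoints.map (pullback.fst g₁ g₂) R, AlgPoints.map (pullback.snd g₁ g₂) R) := by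
  haveI := isClosedImmersion_lift_fst_snd_left g₁ g₂
  have hprod := (AlgPoints.isHomeomorph_prodEquiv_holds (X := Y₁) (Y := Y₂) (L := ℂ)).isEmbedding
  have hc := AlgPoints.isEmbedding_map_of_isClosedImmersion (L := ℂ)
    (CartesianMonoidalCategory.lift (pullback.fst g₁ g₂) (pullback.snd g₁ g₂))
  convert hprod.comp hc using 1
  funext R
  refine Prod.ext ?_ ?_
  · change _ = AlgPoints.map (CartesianMonoidalCategory.fst Y₁ Y₂)
      (AlgPoints.map (CartesianMonoidalCategory.lift (pullback.fst g₁ g₂) (pullback.snd g₁ g₂)) R)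
    rw [← AlgPoints.map_comp_apply, CartesianMonoidalCategory.lift_fst]
  · change _ = AlgPoints.map (CartesianMonoidalCategory.snd Y₁ Y₂)
      (AlgPoints.map (CartesianMonoidalCategory.lift (pullback.fst g₁ g₂) (pullback.snd g₁ g₂)) R)
    rw [← AlgPoints.map_comp_apply, CartesianMonoidalCategory.lift_snd]

end FibreProduct

/-! ### Unramified ⇒ locally injective on complex points (SGA1 XII 3.1 (ii), shadow) -/

section LocallyInjective

variable {Y : Motives.SchemeOver ℂ}

/-- The diagonal `Y ⟶ Y ×_X Y` in `Over (Spec ℂ)` has as underlying morphism, up to the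
isomorphism `(Y ×_X Y).left ≅ Y.left ×_{X.left} Y.left`, the diagonal of `Y.left ⟶ X.left`;
hence it is an open immersion when the latter is unramified (Mathlib
`isOpenImmersion_diagonal`). [folklore] -/
theorem isOpenImmersion_diagonal_left (g : Y ⟶ X) [FormallyUnramified g.left]
    [LocallyOfFiniteType g.left] : IsOpenImmersion (pullback.diagonal g).left := by
  let G := Over.forget (Spec (CommRingCat.of ℂ))
  have : FormallyUnramified (G.map g) := ‹FormallyUnramified g.left›
  have : LocallyOfFiniteType (G.map g) := ‹LocallyOfFiniteType g.left›
  have h : G.map (pullback.diagonal g) ≫ (PreservesPullback.iso G g g).hom =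
      pullback.diagonal (G.map g) := by
    apply pullback.hom_ext
    · rw [Category.assoc, PreservesPullback.iso_hom_fst, ← G.map_comp, pullback.diagonal_fst,
        pullback.diagonal_fst, G.map_id]
    · rw [Category.assoc, PreservesPullback.iso_hom_snd, ← G.map_comp, pullback.diagonal_snd,
        pullback.diagonal_snd, G.map_id]
  change IsOpenImmersion (G.map (pullback.diagonal g))
  rw [← MorphismProperty.cancel_right_of_respectsIso @IsOpenImmersion _
    (PreservesPullback.iso G g g).hom, h]
  infer_instance

/-- **`g(ℂ)` is locally injective for `g : Y ⟶ X` unramified** (formally unramified and locally of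
finite type), `X` separated over `ℂ` — the topological shadow of SGA1 XII Prop. 3.1 (ii) («`f`
net ⇔ `f^an` net»). The diagonal of `Y(ℂ)` is the image of the open immersion
`Y ⟶ Y ×_X Y` on complex points, hence open in `(Y ×_X Y)(ℂ)` (`AlgPoints.isOpen_range_map`),
which embeds into `Y(ℂ) × Y(ℂ)` (`isEmbedding_map_fst_snd`); so near `(y₀, y₀)` it is cut out by a
product neighbourhood `U × U`, and two points of `U` with the same image under `g(ℂ)` define a
point of `(Y ×_X Y)(ℂ)` in `U × U`, i.e. on the diagonal. [cite: SGA1, Exp. XII Prop. 3.1 (ii)] -/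
theorem isLocallyInjective_map_of_formallyUnramified [IsSeparated X.hom] (g : Y ⟶ X)
    [FormallyUnramified g.left] [LocallyOfFiniteType g.left] :
    IsLocallyInjective (AlgPoints.map g : Motives.ComplexPoints Y → Motives.ComplexPoints X) := by
  haveI := isOpenImmersion_diagonal_left g
  let Δ : Y ⟶ pullback g g := pullback.diagonal g
  let E : Motives.ComplexPoints (pullback g g) → Motives.ComplexPoints Y × Motives.ComplexPoints Y :=
    fun R ↦ (AlgPoints.map (pullback.fst g g) R, AlgPoints.map (pullback.snd g g) R)
  have hE : IsEmbedding E := isEmbedding_map_fst_snd g g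
  have hO : IsOpen (Set.range (AlgPoints.map Δ : Motives.ComplexPoints Y → _)) :=
    AlgPoints.isOpen_range_map Δ
  obtain ⟨N, hNo, hNE⟩ := hE.isInducing.isOpen_iff.mp hO
  intro y₀
  have hy₀ : (y₀, y₀) ∈ N := by
    have : AlgPoints.map Δ y₀ ∈ E ⁻¹' N := by rw [hNE]; exact Set.mem_range_self y₀
    rw [Set.mem_preimage] at this
    convert this using 1
    refine Prod.ext ?_ ?_
    · change y₀ = AlgPoints.map (pullback.fst g g) (AlgPoints.map Δ y₀)
      rw [← AlgPoints.map_comp_apply, pullback.diagonal_fst, AlgPoints.map_id_apply]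
    · change y₀ = AlgPoints.map (pullback.snd g g) (AlgPoints.map Δ y₀)
      rw [← AlgPoints.map_comp_apply, pullback.diagonal_snd, AlgPoints.map_id_apply]
  obtain ⟨u, v, hu, hv, hyu, hyv, huv⟩ := isOpen_prod_iff.mp hNo y₀ y₀ hy₀
  refine ⟨u ∩ v, hu.inter hv, ⟨hyu, hyv⟩, fun y hy y' hy' hyy' ↦ ?_⟩
  -- the point `(y, y')` of `(Y ×_X Y)(ℂ)` lies in `N`, hence on the diagonal
  let R : Motives.ComplexPoints (pullback g g) := pullback.lift y y' hyy'
  have hR₁ : AlgPoints.map (pullback.fst g g) R = y := pullback.lift_fst _ _ _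
  have hR₂ : AlgPoints.map (pullback.snd g g) R = y' := pullback.lift_snd _ _ _
  have hRN : R ∈ E ⁻¹' N := by
    change (AlgPoints.map (pullback.fst g g) R, AlgPoints.map (pullback.snd g g) R) ∈ N
    rw [hR₁, hR₂]
    exact huv ⟨hy.1, hy'.2⟩
  rw [hNE] at hRN
  obtain ⟨y'', hy''⟩ := hRN
  rw [← hR₁, ← hR₂, ← hy'', ← AlgPoints.map_comp_apply, ← AlgPoints.map_comp_apply,
    pullback.diagonal_fst, pullback.diagonal_snd]

end LocallyInjective

/-! ### Part 1 of SGA1 XII 5.1 over a separated base -/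

section PartOne

variable {Y₁ Y₂ : Motives.SchemeOver ℂ}

/-- **Part 1 of Riemann's existence theorem (SGA1 XII Thm. 5.1) over a separated base, covering
form.** Let `X` be separated over `ℂ`, `g₁ : Y₁ ⟶ X` with `Y₁` locally of finite type over `ℂ`,
and `g₂ : Y₂ ⟶ X` FINITE ÉTALE. Then every continuous map `Ψ : Y₁(ℂ) → Y₂(ℂ)` over `X(ℂ)` is the
map on complex points of a unique `X`-morphism `u : Y₁ ⟶ Y₂`: «Le foncteur `Ψ` qui, à tout
revêtement étale fini `X'` de `X`, associe `X'^an` est … pleinement fidèle». Assembled from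
`existsUnique_hom_comp_eq_and_map_eq_of_continuous` with the local injectivity of `g₂(ℂ)`
(`isLocallyInjective_map_of_formallyUnramified`) and the Hausdorffness of `Y₂(ℂ)` (`Y₂` is
separated over `ℂ`, `ComplexPoints.t2Space_of_isSeparated`).
[cite: SGA1, Exp. XII Thm. 5.1 (part 1)] -/
theorem existsUnique_hom_comp_eq_and_map_eq [IsSeparated X.hom] [LocallyOfFiniteType Y₁.hom]
    (g₁ : Y₁ ⟶ X) (g₂ : Y₂ ⟶ X) [IsFinite g₂.left] [Etale g₂.left]
    (Ψ : Motives.ComplexPoints Y₁ → Motives.ComplexPoints Y₂)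
    (hΨ : ∀ a, AlgPoints.map g₂ (Ψ a) = AlgPoints.map g₁ a) (hcont : Continuous Ψ) :
    ∃! u : Y₁ ⟶ Y₂, u ≫ g₂ = g₁ ∧
      (AlgPoints.map u : Motives.ComplexPoints Y₁ → Motives.ComplexPoints Y₂) = Ψ := by
  haveI : IsSeparated Y₂.hom := by rw [← Over.w g₂]; infer_instance
  haveI : T2Space (Motives.ComplexPoints Y₂) := ComplexPoints.t2Space_of_isSeparated Y₂
  exact existsUnique_hom_comp_eq_and_map_eq_of_continuous g₁ g₂ Ψ hΨ hcont
    (isLocallyInjective_map_of_formallyUnramified g₂)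

/-- **Maps of complex points between finite étale covers of a separated `X` are algebraic**: for
`g₁ : Y₁ ⟶ X`, `g₂ : Y₂ ⟶ X` both finite étale (`X` separated over `ℂ`, locally of finite type)
and a continuous `Ψ : Y₁(ℂ) → Y₂(ℂ)` over `X(ℂ)`, there is a unique `u ∈ Hom_X(Y₁, Y₂)` with
`u(ℂ) = Ψ` — full faithfulness of `X' ↦ X'(ℂ)` on finite étale covers (SGA1 XII 5.1, part 1).
[cite: SGA1, Exp. XII Thm. 5.1 (part 1)] -/
theorem existsUnique_hom_of_isFinite_of_etale [IsSeparated X.hom] [LocallyOfFiniteType X.hom]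
    (g₁ : Y₁ ⟶ X) (g₂ : Y₂ ⟶ X) [IsFinite g₁.left] [IsFinite g₂.left] [Etale g₂.left]
    (Ψ : Motives.ComplexPoints Y₁ → Motives.ComplexPoints Y₂)
    (hΨ : ∀ a, AlgPoints.map g₂ (Ψ a) = AlgPoints.map g₁ a) (hcont : Continuous Ψ) :
    ∃! u : Y₁ ⟶ Y₂, u ≫ g₂ = g₁ ∧
      (AlgPoints.map u : Motives.ComplexPoints Y₁ → Motives.ComplexPoints Y₂) = Ψ := by
  haveI : LocallyOfFiniteType Y₁.hom := by rw [← Over.w g₁]; infer_instance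
  exact existsUnique_hom_comp_eq_and_map_eq g₁ g₂ Ψ hΨ hcont

/-- **Homeomorphisms between finite étale covers are algebraic isomorphisms** (SGA1 XII 5.1,
part 1, isomorphism form: «`Xᵢ → X'` est un isomorphisme si et seulement si `Xᵢ^an → X'^an`
l'est»): for `g₁ : Y₁ ⟶ X`, `g₂ : Y₂ ⟶ X` finite étale over a separated `X` locally of finite type
over `ℂ`, every homeomorphism `Ψ : Y₁(ℂ) ≃ₜ Y₂(ℂ)` over `X(ℂ)` is `u(ℂ)` for a unique
`X`-morphism `u`, and `u` is an isomorphism (apply full faithfulness to `Ψ` and `Ψ⁻¹` and use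
uniqueness). This is the form in which a TOPOLOGICAL descent datum on a finite étale cover becomes
an ALGEBRAIC one (SGA1 XII 5.1, proof, part 2 a), descent along the normalisation).
[cite: SGA1, Exp. XII Thm. 5.1 (part 1 and its use in part 2 a))] -/
theorem existsUnique_iso_of_homeomorph [IsSeparated X.hom] [LocallyOfFiniteType X.hom]
    (g₁ : Y₁ ⟶ X) (g₂ : Y₂ ⟶ X) [IsFinite g₁.left] [Etale g₁.left] [IsFinite g₂.left]
    [Etale g₂.left] (Ψ : Motives.ComplexPoints Y₁ ≃ₜ Motives.ComplexPoints Y₂)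
    (hΨ : ∀ a, AlgPoints.map g₂ (Ψ a) = AlgPoints.map g₁ a) :
    ∃! u : Y₁ ⟶ Y₂, (u ≫ g₂ = g₁ ∧
      (AlgPoints.map u : Motives.ComplexPoints Y₁ → Motives.ComplexPoints Y₂) = Ψ) ∧ IsIso u := by
  have hΨ' : ∀ b, AlgPoints.map g₁ (Ψ.symm b) = AlgPoints.map g₂ b := fun b ↦ by
    rw [← hΨ (Ψ.symm b), Homeomorph.apply_symm_apply]
  obtain ⟨u, ⟨hu₁, hu₂⟩, huu⟩ :=
    existsUnique_hom_of_isFinite_of_etale g₁ g₂ Ψ hΨ Ψ.continuous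
  obtain ⟨v, ⟨hv₁, hv₂⟩, -⟩ :=
    existsUnique_hom_of_isFinite_of_etale g₂ g₁ Ψ.symm hΨ' Ψ.symm.continuous
  -- `u ≫ v = 𝟙` and `v ≫ u = 𝟙` by uniqueness
  have huv : u ≫ v = 𝟙 Y₁ := by
    have h1 := (existsUnique_hom_of_isFinite_of_etale g₁ g₁ id (fun _ ↦ rfl) continuous_id).unique
      (y₁ := u ≫ v) (y₂ := 𝟙 Y₁)
    refine h1 ⟨by rw [Category.assoc, hv₁, hu₁], ?_⟩ ⟨Category.id_comp _, ?_⟩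
    · funext a
      rw [AlgPoints.map_comp_apply, congrFun hu₂, congrFun hv₂]
      exact Ψ.symm_apply_apply a
    · funext a
      exact AlgPoints.map_id_apply a
  have hvu : v ≫ u = 𝟙 Y₂ := by
    have h1 := (existsUnique_hom_of_isFinite_of_etale g₂ g₂ id (fun _ ↦ rfl) continuous_id).unique
      (y₁ := v ≫ u) (y₂ := 𝟙 Y₂)
    refine h1 ⟨by rw [Category.assoc, hu₁, hv₁], ?_⟩ ⟨Category.id_comp _, ?_⟩
    · funext b
      rw [AlgPoints.map_comp_apply, congrFun hv₂, congrFun hu₂]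
      exact Ψ.apply_symm_apply b
    · funext b
      exact AlgPoints.map_id_apply b
  exact ⟨u, ⟨⟨hu₁, hu₂⟩, ⟨v, huv, hvu⟩⟩, fun u' hu' ↦ huu u' hu'.1⟩

/-- Isomorphism form of `existsUnique_iso_of_homeomorph`: a homeomorphism of complex points over
`X(ℂ)` between finite étale covers of `X` is induced by an isomorphism over `X`.
[cite: SGA1, Exp. XII Thm. 5.1 (part 1)] -/
theorem exists_iso_of_homeomorph [IsSeparated X.hom] [LocallyOfFiniteType X.hom]
    (g₁ : Y₁ ⟶ X) (g₂ : Y₂ ⟶ X) [IsFinite g₁.left] [Etale g₁.left] [IsFinite g₂.left]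
    [Etale g₂.left] (Ψ : Motives.ComplexPoints Y₁ ≃ₜ Motives.ComplexPoints Y₂)
    (hΨ : ∀ a, AlgPoints.map g₂ (Ψ a) = AlgPoints.map g₁ a) :
    ∃ e : Y₁ ≅ Y₂, e.hom ≫ g₂ = g₁ ∧
      (AlgPoints.map e.hom : Motives.ComplexPoints Y₁ → Motives.ComplexPoints Y₂) = Ψ := by
  obtain ⟨u, ⟨⟨hu₁, hu₂⟩, hu⟩, -⟩ := existsUnique_iso_of_homeomorph g₁ g₂ Ψ hΨ
  exact ⟨asIso u, hu₁, hu₂⟩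

end PartOne

end Literature.AlgebraicGeometry.FundamentalGroup

end
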